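import Literature.NumberTheory.Automorphic.ArtinLFunctionsAbelianConductorProofs
import Literature.NumberTheory.LFunctions.RayClassConductor
import Literature.NumberTheory.GaloisRepresentations.FramedRepBaseChange
import HarnessLib

/-!
# The primitive ray class datum of an Artin character of degree one (Neukirch VII (10.6), Remark)

Topic `Literature/NumberTheory/Automorphic`; namespace `Literature.NumberTheory.Automorphic`.  Pure-proof
companion of `ArtinLFunctionsAbelianConductorProofs.lean` and `LFunctions/RayClassConductor.lean`, a step
towards Artin's functional equation for characters of degree one (`artin_functional_equation_rankOne` of
`ArtinLFunctionsFunctionalEquation.lean`, Neukirch VII (12.5)/(12.6) with Hecke's (8.6)).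

> **Neukirch VII (10.6) and its Remark (p. 526).** For an abelian extension `L|K` with conductor `𝔣`
> and a character `χ` of `G(L|K)`, "one has complete equality `𝓛(L|K, χ, s) = L(χ̃, s)`", where
> `χ̃` is "a *primitive* Größencharakter `mod 𝔣`" (the conductor of `χ̃` is the conductor of the field
> cut out by `χ`, VI (6.6)).

Main result `exists_primitive_rayClass_datum`: for every `ψ : Γ_K → GL_1(ℂ)` there are a nonzero
ideal `𝔣`, a **primitive** ray class character `χ mod 𝔣` (`IsRayClassCharacter`, `IsPrimitive`) of
some sign type `p` (`IsSignType`), with `L(s, ψ) = L(χ, s)` and `L(s, ψ^∨) = L(χ̄, s)` for `re s > 1`.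
Proof: the reciprocity datum `(𝔪, χ̃)` of `artinReciprocity_rankOne_holds` (`𝔪` supported on the
ramified primes of `ψ`) is replaced by its primitive associate `(𝔣, χ₀)` of
`LFunctions.exists_primitive_associate`/`transportChar` (VII §6, p. 472); the finitely many Euler
factors `∏_{𝔭 ∣ 𝔪, 𝔭 ∤ 𝔣} (1 - χ₀(𝔭)𝔑𝔭^{-s})` by which the two L-series differ are shown to be absent
by the analytic argument of `ArtinLFunctionsAbelianConductorProofs` (a zero `it₀` of a missing factor
would be a zero of `ζ_M`, `M` the field cut out by `ψ`, contradicting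
`dedekindZetaCont_ne_zero_of_re_eq_zero`) — a deviation from the printed proof (VI (6.6) by class field
theory), recorded as such.

## References

* J. Neukirch, *Algebraic Number Theory*, Springer 1999, Ch. VII §10 Thm. (10.6) and Remark; §6 p. 472;
  §8 before (8.5); Ch. VI §6 Cor. (6.6). [NeukirchANT1999]
-/

noncomputable section

open scoped NumberField
open Field IsDedekindDomain NumberField Filter Complex
open Literature.NumberTheory.GaloisRepresentations Literature.NumberTheory.LFunctions

universe u

namespace Literature.NumberTheory.Automorphic

variable {K : Type u} [Field K] [NumberField K]

/-! ### The dual of a character of degree one -/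

omit [NumberField K] in
/-- `det ψ^∨ = (det ψ)⁻¹` in degree one (indeed in every degree: `det (gᵀ)⁻¹ = (det g)⁻¹`). [folklore] -/
theorem det_dual_apply {n : ℕ} (ψ : FramedArtinRep K n) (γ : absoluteGaloisGroup K) :
    FramedRep.det (FramedRep.dual ψ) γ = (FramedRep.det ψ γ)⁻¹ := by
  apply Units.ext
  rw [FramedRep.det_apply, FramedRep.det_apply, Matrix.GeneralLinearGroup.val_det_apply, FramedRep.coe_dual_apply,
    Matrix.det_transpose, ← Matrix.GeneralLinearGroup.val_det_apply, map_inv]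

/-! ### Star and the primitive associate -/

section Star

variable {𝔪 : Ideal (𝓞 K)} {χ : HeightOneSpectrum (𝓞 K) → ℂ} {p : Finset {w : InfinitePlace K // w.IsReal}}

/-- Definability passes to `χ̄`. [folklore] -/
theorem _root_.Literature.NumberTheory.LFunctions.IsDefinableMod.star {𝔣 : Ideal (𝓞 K)} (h : IsDefinableMod 𝔪 χ p 𝔣) : IsDefinableMod 𝔪 (star χ) p 𝔣 :=
  ⟨h.le, fun a ha hac ha1 ↦ by rw [finitePart_star, h.finitePart_eq_one a ha hac ha1, map_one]⟩

/-- The primitive associate of `χ̄` is the conjugate of that of `χ` (same transport data). [folklore] -/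
theorem _root_.Literature.NumberTheory.LFunctions.transportChar_star (χ : HeightOneSpectrum (𝓞 K) → ℂ) (𝔣 : Ideal (𝓞 K))
    (𝔟 : HeightOneSpectrum (𝓞 K) → Ideal (𝓞 K)) :
    transportChar K (star χ) 𝔣 𝔟 = star (transportChar K χ 𝔣 𝔟) := by
  classical
  funext v
  simp only [transportChar, Pi.star_apply]
  split_ifs
  · simp
  · rw [idealPow_star]; rfl

end Star

/-! ### The primitive datum -/

section Datum

/-- **The primitive ray class datum of a character of degree one** (Neukirch VII (10.6), Remark: "one has
complete equality `𝓛(L|K, χ, s) = L(χ̃, s)` … `χ̃` is a primitive Größencharakter `mod 𝔣`").  For every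
`ψ : Γ_K → GL_1(ℂ)` there are `𝔣 ≠ 0`, a primitive ray class character `χ mod 𝔣` of sign type `p`, with
`L(s, ψ) = L(χ, s)` and `L(s, ψ^∨) = L(χ̄, s)` on `re s > 1`.
[cite: NeukirchANT1999, Ch. VII §10 Thm. (10.6) (Remark); Ch. VII §6 p. 472; Ch. VI §6 Cor. (6.6)] -/
theorem exists_primitive_rayClass_datum (ψ : FramedArtinRep K 1) :
    ∃ (𝔣 : Ideal (𝓞 K)) (χ : HeightOneSpectrum (𝓞 K) → ℂ) (p : Finset {w : InfinitePlace K // w.IsReal}),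
      𝔣 ≠ ⊥ ∧ IsRayClassCharacter 𝔣 χ ∧ IsPrimitive 𝔣 χ ∧ IsSignType 𝔣 χ p ∧
      (∀ s : ℂ, 1 < s.re → artinLFunction ψ.toArtinRep s = rayClassLSeries 𝔣 χ s) ∧
      (∀ s : ℂ, 1 < s.re →
        artinLFunction (FramedArtinRep.toArtinRep (FramedRep.dual ψ)) s = rayClassLSeries 𝔣 (star χ) s) := by
  classical
  -- the reciprocity datum `(𝔪, χ̃)` and its dual
  obtain ⟨𝔪, h𝔪, χ, hχ, hunr, hram⟩ := artinReciprocity_rankOne_holds K ψ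
  have hL : ∀ s : ℂ, 1 < s.re → artinLFunction ψ.toArtinRep s = rayClassLSeries 𝔪 χ s := fun s hs ↦
    artinLFunction_eq_rayClassLSeries ψ h𝔪 hχ hunr hram hs
  have hunr' : ∀ v : HeightOneSpectrum (𝓞 K), ¬ 𝔪 ≤ v.asIdeal →
      GaloisRep.IsUnramifiedAt v (FramedArtinRep.toArtinRep (FramedRep.dual ψ)) ∧
        ∀ 𝔓 ∈ v.primesAbove, ∀ σ : absoluteGaloisGroup K, IsArithFrobAt (𝓞 K) σ 𝔓 →
          (star χ) v = (FramedRep.det (FramedRep.dual ψ) σ : ℂ) := by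
    intro v hv
    obtain ⟨hur, hval⟩ := hunr v hv
    refine ⟨(FramedGaloisRep.isUnramifiedAt_toGaloisRep_iff v _).mpr
      ((FramedGaloisRep.isUnramifiedAt_dual_iff v ψ).mpr ((FramedGaloisRep.isUnramifiedAt_toGaloisRep_iff v ψ).mp hur)),
      fun 𝔓 h𝔓 σ hσ ↦ ?_⟩
    have h1 : ‖χ v‖ = 1 := hχ.norm_eq_one v hv
    rw [Pi.star_apply, det_dual_apply, Units.val_inv_eq_inv_val, ← hval 𝔓 h𝔓 σ hσ, Complex.inv_eq_conj h1]
    rfl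
  have hram' : ∀ v : HeightOneSpectrum (𝓞 K), 𝔪 ≤ v.asIdeal →
      ¬ GaloisRep.IsUnramifiedAt v (FramedArtinRep.toArtinRep (FramedRep.dual ψ)) := fun v hv h ↦
    hram v hv ((FramedGaloisRep.isUnramifiedAt_toGaloisRep_iff v ψ).mpr
      ((FramedGaloisRep.isUnramifiedAt_dual_iff v ψ).mp ((FramedGaloisRep.isUnramifiedAt_toGaloisRep_iff v _).mp h)))
  have hL' : ∀ s : ℂ, 1 < s.re →
      artinLFunction (FramedArtinRep.toArtinRep (FramedRep.dual ψ)) s = rayClassLSeries 𝔪 (star χ) s := fun s hs ↦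
    artinLFunction_eq_rayClassLSeries (FramedRep.dual ψ) h𝔪 hχ.star hunr' hram' hs
  -- the primitive associate `(𝔣, χ₀)` of `(𝔪, χ̃)`
  obtain ⟨p, hp⟩ := hχ.exists_isSignType h𝔪
  obtain ⟨𝔣, hD, hmax⟩ := exists_conductor hp h𝔪
  obtain ⟨𝔟, h𝔟⟩ := exists_isTransportData h𝔪 hD.le
  set χ₀ := transportChar K χ 𝔣 𝔟 with hχ₀
  have h𝔣0 : 𝔣 ≠ ⊥ := fun h ↦ h𝔪 (le_bot_iff.mp (h ▸ hD.le))
  have hχ₀ : IsRayClassCharacter 𝔣 χ₀ := isRayClassCharacter_transportChar hχ hp h𝔪 hD h𝔟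
  have hprim : IsPrimitive 𝔣 χ₀ := isPrimitive_transportChar hχ hp h𝔪 hD hmax h𝔟
  have hsign : IsSignType 𝔣 χ₀ p := isSignType_transportChar hχ hp h𝔪 hD h𝔟
  set T : Finset (HeightOneSpectrum (𝓞 K)) :=
    (Ideal.finite_factors h𝔪).toFinset.filter (fun v ↦ ¬ 𝔣 ≤ v.asIdeal) with hT
  have hmemT : ∀ v, v ∈ T ↔ 𝔪 ≤ v.asIdeal ∧ ¬ 𝔣 ≤ v.asIdeal := fun v ↦ by
    rw [hT, Finset.mem_filter, Set.Finite.mem_toFinset, Set.mem_setOf_eq, Ideal.dvd_iff_le]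
  set P : ℂ → ℂ := fun s ↦ ∏ v ∈ T, (1 - χ₀ v * ((Ideal.absNorm v.asIdeal : ℕ) : ℂ) ^ (-s)) with hPdef
  have hE : ∀ s : ℂ, 1 < s.re → rayClassLSeries 𝔪 χ s = rayClassLSeries 𝔣 χ₀ s * P s := fun s hs ↦
    rayClassLSeries_eq_mul_prod_transportChar hχ hp h𝔪 hD h𝔟 hs
  have hE' : ∀ s : ℂ, 1 < s.re → rayClassLSeries 𝔪 (star χ) s = rayClassLSeries 𝔣 (star χ₀) s *
      ∏ v ∈ T, (1 - (star χ₀) v * ((Ideal.absNorm v.asIdeal : ℕ) : ℂ) ^ (-s)) := fun s hs ↦ by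
    have := rayClassLSeries_eq_mul_prod_transportChar hχ.star hp.star h𝔪 hD.star h𝔟 hs
    rwa [transportChar_star] at this
  -- it suffices that no Euler factor is missing
  suffices hTe : T = ∅ by
    refine ⟨𝔣, χ₀, p, h𝔣0, hχ₀, hprim, hsign, fun s hs ↦ ?_, fun s hs ↦ ?_⟩
    · rw [hL s hs, hE s hs, hPdef]
      simp only [hTe, Finset.prod_empty, mul_one]
    · rw [hL' s hs, hE' s hs, hTe, Finset.prod_empty, mul_one]
  by_contra hne
  obtain ⟨v₀, hv₀⟩ := Finset.nonempty_iff_ne_empty.mpr hne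
  obtain ⟨hv₀m, hv₀f⟩ := (hmemT v₀).mp hv₀
  -- (1) `ψ` is non-trivial (it ramifies at `v₀ ∣ 𝔪`)
  have hψnt : ∃ γ, FramedRep.det ψ γ ≠ 1 := by
    by_contra hall
    push Not at hall
    exact hram v₀ hv₀m ((FramedGaloisRep.isUnramifiedAt_toGaloisRep_iff v₀ ψ).mpr
      fun 𝔓 _ σ _ ↦ (det_eq_one_iff_rankOne ψ σ).mp (hall σ))
  -- (2) `P` is entire
  have hPd : Differentiable ℂ P := by
    have hq : ∀ v : HeightOneSpectrum (𝓞 K), ((Ideal.absNorm v.asIdeal : ℕ) : ℂ) ≠ 0 := fun v ↦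
      Nat.cast_ne_zero.mpr (by have := HeightOneSpectrum.one_lt_absNorm v; omega)
    refine Differentiable.fun_finsetProd fun v _ ↦ ?_
    exact (differentiable_const _).fun_sub ((differentiable_const _).fun_mul
      (differentiable_id.fun_neg.const_cpow (Or.inl (hq v))))
  -- (3) continuations: `G` of `L(χ₀, s)`, `F j` of `L(s, ψ^j)`, and `ζ_M = ∏ F j`
  obtain ⟨G, -, hGd, hGs⟩ := rayClassLSeries_hasMeromorphicContinuation_holds (K := K) 𝔣 h𝔣0 χ₀ hχ₀
  obtain ⟨Ψ, hΨ1, -, M, _, _, n, h1n, hζ⟩ := exists_dedekindZeta_eq_prod_artinLFunction_pow ψ hψnt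
  have hF := fun j : ℕ ↦ exists_differentiableOn_eq_artinLFunction_rankOne (Ψ j)
  choose F hFd hFs using hF
  -- (4) the identity theorem, twice
  have hU : ({0, 1}ᶜ : Set ℂ) ⊆ ({1}ᶜ : Set ℂ) := Set.compl_subset_compl.mpr (Set.subset_insert _ _)
  have hζd : DifferentiableOn ℂ (dedekindZetaCont M) ({0, 1}ᶜ : Set ℂ) :=
    (NumberField.isDedekindZetaContinuation_dedekindZetaCont_holds M).differentiableOn.mono hU
  have hprod : Set.EqOn (dedekindZetaCont M) (fun s ↦ ∏ j ∈ Finset.range n, F j s) ({0, 1}ᶜ : Set ℂ) := by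
    refine eqOn_compl_zero_one_of_eqOn_one_lt_re hζd (DifferentiableOn.fun_finsetProd fun j _ ↦ hFd j) fun s hs ↦ ?_
    rw [(NumberField.isDedekindZetaContinuation_dedekindZetaCont_holds M).eqOn hs, hζ s hs]
    exact Finset.prod_congr rfl fun j _ ↦ (hFs j s hs).symm
  have hone : Set.EqOn (F 1) (G * P) ({0, 1}ᶜ : Set ℂ) := by
    refine eqOn_compl_zero_one_of_eqOn_one_lt_re (hFd 1) (hGd.mul hPd.differentiableOn) fun s hs ↦ ?_
    rw [hFs 1 s hs, hΨ1, hL s hs, hE s hs, Pi.mul_apply, hGs s hs]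
  -- (5) the zero `s₀ = it₀` of the missing Euler factor at `v₀`
  obtain ⟨s₀, hre, him, hv₀0⟩ := exists_one_sub_mul_cpow_neg_eq_zero (hχ₀.norm_eq_one v₀ hv₀f)
    (HeightOneSpectrum.one_lt_absNorm v₀)
  have hs₀U : s₀ ∈ ({0, 1}ᶜ : Set ℂ) := by
    simp only [Set.mem_compl_iff, Set.mem_insert_iff, Set.mem_singleton_iff, not_or]
    exact ⟨fun h ↦ him (by rw [h]; simp), fun h ↦ him (by rw [h]; simp)⟩
  have hP0 : P s₀ = 0 := Finset.prod_eq_zero hv₀ hv₀0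
  -- (6) `ζ_M(s₀) = 0`: contradiction
  have hζ0 : dedekindZetaCont M s₀ = 0 := by
    rw [hprod hs₀U]
    show ∏ j ∈ Finset.range n, F j s₀ = 0
    refine Finset.prod_eq_zero (Finset.mem_range.mpr h1n) ?_
    rw [hone hs₀U, Pi.mul_apply, hP0, mul_zero]
  exact dedekindZetaCont_ne_zero_of_re_eq_zero M hre him hζ0

end Datum

end Literature.NumberTheory.Automorphic
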